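import Mathlib
import HarnessLib

/-!
# Rung C1 of the crux `EulerZoomLiouville.PowerGaugeEulerLiouville` at the endpoint `ρ = 1/2`:
# the shell-energy iteration (real-variable part of Chae–Shvydkoy 2013, Thm 3.1)

Route №10 `EulerZoomLiouville` (NavierStokesRegularity), crux E = stmt-NavierStokesRegularity-19832,
tenure rung C1 (exactly self-similar members) at the energy-conserving endpoint `ρ = 1/2`
(Chae–Shvydkoy `α = N/2 = 3/2`).  Chae–Shvydkoy (ARMA 209 (2013) = arXiv:1201.6009, Thm 3.1)
exclude energy-conserving self-similar Euler profiles `v ∈ L² ∩ C¹_loc` with a power spread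
`c|y|^{-(N+1-δ)} ≤ |v(y)| ≤ C|y|^{1-δ}` by iterating a recursion for the dyadic shell energies
`e(L) = ∫_{L ≤ |y| < 2L} |v|²` obtained from the local energy balance and the Riesz pressure.

This file isolates the REAL-VARIABLE ITERATION, in a form that uses the lower power bound only
at the very end (so that, in the weak class of the crux, the recursion can be fed with the
sublinear far-field pressure terms):

* `shell_recursion_step` — one bootstrap step: a bound `f(L) ≤ D L^{-a}` (`L ≥ 1`) and the
  recursion `f(L) ≤ C₁ L^{-δ} S(L) + C₂ √(S(L)) L^{-κ}` (`L ≥ L₁`), `S(L) = Σ_{|j| ≤ m} f(2^j L)`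
  the dyadic window sum, give `f(L) ≤ D' L^{-b}` for every `0 ≤ b ≤ min(a + δ, a/2 + κ)`;
* `shell_decay_of_recursion` — hence `f(L) ≤ C_ε L^{-2κ+ε}` for every `ε > 0` (the exponent
  map `a ↦ min(a+δ, a/2+κ)` increases to its fixed point `2κ`); with `κ = 5/2` this is the
  energy drain rate `L^{-(N+2)+ε}`, `N = 3`, of Shvydkoy's energy-measure paper as quoted in
  Bronzi–Shvydkoy (arXiv:1310.8611, Remark 1.5);
* `false_of_shell_recursion_of_lower_bound` — a lower bound `f(L) ≥ c L^{-2κ+η}` (`η > 0`) is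
  then contradictory: the endgame of Chae–Shvydkoy's Thm 3.1 (`c²|y|^{-2(4-δ)}` integrates to
  `≳ L^{-5+2δ}` over a dyadic shell).

Pure real analysis (no measure theory); the PDE input is in the sequel files.

WHAT THIS IS NOT: not NS, not E, not rung C1 — bookkeeping for one endpoint stratum.
-/

noncomputable section

-- flat `Theorems/<Route><Decl>…` files of one crux share the namespace of the crux (tree convention)
set_option linter.dupNamespace false

open Finset Filter

namespace Summit.NavierStokesRegularity.NavierStokesRegularity.Theorems.PowerGaugeEulerLiouville

section Iteration

variable {f S : ℝ → ℝ} {B C₁ C₂ δ κ L₁ : ℝ} {m : ℕ}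

/-- The dyadic window sum of a nonnegative `f` is nonnegative. [folklore] -/
theorem windowSum_nonneg (hf0 : ∀ L, 0 < L → 0 ≤ f L)
    (hS : ∀ L, S L = ∑ k ∈ range (2 * m + 1), f (2 ^ k * L / 2 ^ m)) {L : ℝ} (hL : 0 < L) :
    0 ≤ S L := by
  rw [hS]
  exact sum_nonneg fun k _ => hf0 _ (by positivity)

/-- The dyadic window sum under a power bound: if `f ≥ 0` and `f(L) ≤ D L^{-a}` for `L ≥ 1`
(`a ≥ 0`), then `S(L) ≤ (2m+1) D (2^m)^a L^{-a}` for `L ≥ 2^m`. [folklore] -/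
theorem windowSum_le_of_pow_bound (hf0 : ∀ L, 0 < L → 0 ≤ f L)
    (hS : ∀ L, S L = ∑ k ∈ range (2 * m + 1), f (2 ^ k * L / 2 ^ m))
    {D a : ℝ} (ha : 0 ≤ a) (hD : ∀ L, 1 ≤ L → f L ≤ D * L ^ (-a)) {L : ℝ}
    (hL : (2 : ℝ) ^ m ≤ L) :
    S L ≤ (2 * m + 1) * (D * ((2 : ℝ) ^ m) ^ a) * L ^ (-a) := by
  have h2m : (0 : ℝ) < 2 ^ m := by positivity
  have hL0 : 0 < L := h2m.trans_le hL
  have hLm : 1 ≤ L / 2 ^ m := by rwa [le_div_iff₀ h2m, one_mul]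
  have hD0 : 0 ≤ D := by
    have h1 := hD 1 le_rfl
    rw [Real.one_rpow, mul_one] at h1
    exact (hf0 1 one_pos).trans h1
  rw [hS]
  have hterm : ∀ k ∈ range (2 * m + 1),
      f (2 ^ k * L / 2 ^ m) ≤ (D * ((2 : ℝ) ^ m) ^ a) * L ^ (-a) := by
    intro k _
    have hk1 : (1 : ℝ) ≤ 2 ^ k := one_le_pow₀ (by norm_num)
    have hx1 : 1 ≤ 2 ^ k * L / 2 ^ m := by
      rw [mul_div_assoc]
      exact one_le_mul_of_one_le_of_one_le hk1 hLm
    calc f (2 ^ k * L / 2 ^ m) ≤ D * (2 ^ k * L / 2 ^ m) ^ (-a) := hD _ hx1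
      _ ≤ D * (L / 2 ^ m) ^ (-a) := by
          refine mul_le_mul_of_nonneg_left ?_ hD0
          refine Real.rpow_le_rpow_of_nonpos (by positivity) ?_ (by linarith)
          rw [mul_div_assoc]
          exact le_mul_of_one_le_left (by positivity) hk1
      _ = (D * ((2 : ℝ) ^ m) ^ a) * L ^ (-a) := by
          rw [Real.div_rpow hL0.le h2m.le, Real.rpow_neg h2m.le, div_inv_eq_mul]
          ring
  calc ∑ k ∈ range (2 * m + 1), f (2 ^ k * L / 2 ^ m)
      ≤ ∑ k ∈ range (2 * m + 1), (D * ((2 : ℝ) ^ m) ^ a) * L ^ (-a) := sum_le_sum hterm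
    _ = (2 * m + 1) * (D * ((2 : ℝ) ^ m) ^ a) * L ^ (-a) := by
        rw [sum_const, card_range, nsmul_eq_mul]
        push_cast
        ring

/-- **One bootstrap step of the shell recursion.**  Let `f ≥ 0` be bounded by `B` on `(0, ∞)`
and satisfy, for `L ≥ L₁`, `f(L) ≤ C₁ L^{-δ} S(L) + C₂ √(S(L)) L^{-κ}` with the dyadic window
sum `S(L) = Σ_{k=0}^{2m} f(2^k L/2^m)`.  If `f(L) ≤ D L^{-a}` for all `L ≥ 1` (`a ≥ 0`), then
`f(L) ≤ D' L^{-b}` for all `L ≥ 1`, for every `0 ≤ b` with `b ≤ a + δ` and `b ≤ a/2 + κ`.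
(The linear term improves the exponent by `δ`, the square-root term averages it with `2κ`.)
[cite: ChaeShvydkoy2013, §3.1 proof of Thm. 3.1 (iteration of (3.3))] -/
theorem shell_recursion_step (hf0 : ∀ L, 0 < L → 0 ≤ f L) (hfB : ∀ L, 0 < L → f L ≤ B)
    (hC₁ : 0 ≤ C₁) (hC₂ : 0 ≤ C₂) (hL₁ : 0 < L₁)
    (hS : ∀ L, S L = ∑ k ∈ range (2 * m + 1), f (2 ^ k * L / 2 ^ m))
    (hrec : ∀ L, L₁ ≤ L → f L ≤ C₁ * L ^ (-δ) * S L + C₂ * Real.sqrt (S L) * L ^ (-κ))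
    {D a b : ℝ} (ha : 0 ≤ a) (hD : ∀ L, 1 ≤ L → f L ≤ D * L ^ (-a))
    (hb0 : 0 ≤ b) (hb1 : b ≤ a + δ) (hb2 : b ≤ a / 2 + κ) :
    ∃ D' : ℝ, ∀ L, 1 ≤ L → f L ≤ D' * L ^ (-b) := by
  have h2m : (0 : ℝ) < 2 ^ m := by positivity
  set L₂ : ℝ := max L₁ (2 ^ m) with hL₂
  have hL₂0 : 0 < L₂ := lt_max_of_lt_left hL₁
  have hB0 : 0 ≤ B := (hf0 1 one_pos).trans (hfB 1 one_pos)
  have hD0 : 0 ≤ D := by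
    have h1 := hD 1 le_rfl
    rw [Real.one_rpow, mul_one] at h1
    exact (hf0 1 one_pos).trans h1
  set E : ℝ := (2 * m + 1) * (D * ((2 : ℝ) ^ m) ^ a) with hE
  have hE0 : 0 ≤ E := by positivity
  refine ⟨max (B * L₂ ^ b) (C₁ * E + C₂ * Real.sqrt E), fun L hL => ?_⟩
  have hL0 : 0 < L := one_pos.trans_le hL
  have hLb : 0 < L ^ (-b) := Real.rpow_pos_of_pos hL0 _
  rcases lt_or_ge L L₂ with hlt | hge
  · -- small scales: the crude bound
    have h1 : f L ≤ B := hfB L hL0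
    have h2 : (1 : ℝ) ≤ L₂ ^ b * L ^ (-b) := by
      rw [Real.rpow_neg hL0.le, ← div_eq_mul_inv, ← Real.div_rpow hL₂0.le hL0.le]
      exact Real.one_le_rpow ((one_le_div hL0).2 hlt.le) hb0
    calc f L ≤ B * (L₂ ^ b * L ^ (-b)) := by nlinarith
      _ = (B * L₂ ^ b) * L ^ (-b) := by ring
      _ ≤ max (B * L₂ ^ b) (C₁ * E + C₂ * Real.sqrt E) * L ^ (-b) :=
          mul_le_mul_of_nonneg_right (le_max_left _ _) hLb.le
  · -- large scales: the recursion
    have hL₁L : L₁ ≤ L := (le_max_left _ _).trans hge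
    have hmL : (2 : ℝ) ^ m ≤ L := (le_max_right _ _).trans hge
    have hSle : S L ≤ E * L ^ (-a) := by
      have := windowSum_le_of_pow_bound hf0 hS ha hD hmL
      rw [hE]; linarith
    have hS0 : 0 ≤ S L := windowSum_nonneg hf0 hS hL0
    have hLa : 0 < L ^ (-a) := Real.rpow_pos_of_pos hL0 _
    -- the two exponent comparisons (`L ≥ 1`)
    have hpow1 : L ^ (-δ) * L ^ (-a) ≤ L ^ (-b) := by
      rw [← Real.rpow_add hL0]
      exact Real.rpow_le_rpow_of_exponent_le hL (by linarith)
    have hpow2 : Real.sqrt (L ^ (-a)) * L ^ (-κ) ≤ L ^ (-b) := by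
      rw [Real.sqrt_eq_rpow, ← Real.rpow_mul hL0.le, ← Real.rpow_add hL0]
      exact Real.rpow_le_rpow_of_exponent_le hL (by linarith)
    have hsqrt : Real.sqrt (S L) ≤ Real.sqrt E * Real.sqrt (L ^ (-a)) := by
      rw [← Real.sqrt_mul hE0]
      exact Real.sqrt_le_sqrt hSle
    calc f L ≤ C₁ * L ^ (-δ) * S L + C₂ * Real.sqrt (S L) * L ^ (-κ) := hrec L hL₁L
      _ ≤ C₁ * L ^ (-δ) * (E * L ^ (-a)) + C₂ * (Real.sqrt E * Real.sqrt (L ^ (-a))) * L ^ (-κ) := by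
          gcongr
      _ = C₁ * E * (L ^ (-δ) * L ^ (-a)) + C₂ * Real.sqrt E * (Real.sqrt (L ^ (-a)) * L ^ (-κ)) := by
          ring
      _ ≤ C₁ * E * L ^ (-b) + C₂ * Real.sqrt E * L ^ (-b) := by
          gcongr
      _ = (C₁ * E + C₂ * Real.sqrt E) * L ^ (-b) := by ring
      _ ≤ max (B * L₂ ^ b) (C₁ * E + C₂ * Real.sqrt E) * L ^ (-b) :=
          mul_le_mul_of_nonneg_right (le_max_right _ _) hLb.le

/-- **Super-algebraic iteration to the fixed point `2κ`.**  Under the hypotheses of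
`shell_recursion_step` (nonnegative bounded `f`, the shell recursion with constants
`δ, κ > 0`), for every `ε > 0` there is `C` with `f(L) ≤ C L^{-2κ+ε}` for all `L ≥ 1`.
With `κ = 5/2` (the far-field pressure of an `L²` field in `ℝ³`) this is the shell-energy
drain rate `L^{-5+ε}` of energy-conserving self-similar Euler profiles with sublinear growth.
[cite: ChaeShvydkoy2013, §3.1 proof of Thm. 3.1 (iteration of (3.3))] -/
theorem shell_decay_of_recursion (hf0 : ∀ L, 0 < L → 0 ≤ f L) (hfB : ∀ L, 0 < L → f L ≤ B)
    (hδ : 0 < δ) (hC₁ : 0 ≤ C₁) (hC₂ : 0 ≤ C₂) (hL₁ : 0 < L₁)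
    (hS : ∀ L, S L = ∑ k ∈ range (2 * m + 1), f (2 ^ k * L / 2 ^ m))
    (hrec : ∀ L, L₁ ≤ L → f L ≤ C₁ * L ^ (-δ) * S L + C₂ * Real.sqrt (S L) * L ^ (-κ))
    {ε : ℝ} (hε : 0 < ε) :
    ∃ C : ℝ, ∀ L, 1 ≤ L → f L ≤ C * L ^ (-(2 * κ) + ε) := by
  have hB0 : 0 ≤ B := (hf0 1 one_pos).trans (hfB 1 one_pos)
  -- trivial when the target exponent is nonnegative
  by_cases hεκ : 2 * κ ≤ ε
  · refine ⟨B, fun L hL => ?_⟩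
    have hL0 : 0 < L := one_pos.trans_le hL
    calc f L ≤ B * 1 := by rw [mul_one]; exact hfB L hL0
      _ ≤ B * L ^ (-(2 * κ) + ε) :=
          mul_le_mul_of_nonneg_left (Real.one_le_rpow hL (by linarith)) hB0
  push Not at hεκ
  set η : ℝ := min δ (ε / 2) with hη
  have hη0 : 0 < η := lt_min hδ (by linarith)
  have hηδ : η ≤ δ := min_le_left _ _
  have hηε : η ≤ ε / 2 := min_le_right _ _
  -- `Q n`: the bound with exponent `min (n η) (2κ - ε)`
  have hQ : ∀ n : ℕ, ∃ D : ℝ, ∀ L, 1 ≤ L → f L ≤ D * L ^ (-(min ((n : ℝ) * η) (2 * κ - ε))) := by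
    intro n
    induction n with
    | zero =>
      refine ⟨B, fun L hL => ?_⟩
      have hL0 : 0 < L := one_pos.trans_le hL
      have h0 : min ((0 : ℕ) * η) (2 * κ - ε) = (0 : ℝ) := by
        rw [Nat.cast_zero, zero_mul]
        exact min_eq_left (by linarith)
      rw [h0, neg_zero, Real.rpow_zero, mul_one]
      exact hfB L hL0
    | succ n ih =>
      obtain ⟨D, hD⟩ := ih
      set a : ℝ := min ((n : ℝ) * η) (2 * κ - ε) with ha
      set b : ℝ := min (((n + 1 : ℕ) : ℝ) * η) (2 * κ - ε) with hb
      have ha0 : 0 ≤ a := le_min (by positivity) (by linarith)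
      have hb0 : 0 ≤ b := le_min (by positivity) (by linarith)
      have hab : b ≤ a + η := by
        rcases le_or_gt ((n : ℝ) * η) (2 * κ - ε) with h | h
        · have : a = (n : ℝ) * η := min_eq_left h
          rw [this, hb]
          refine (min_le_left _ _).trans ?_
          push_cast
          linarith
        · have : a = 2 * κ - ε := min_eq_right h.le
          rw [this, hb]
          exact (min_le_right _ _).trans (by linarith)
      have hb1 : b ≤ a + δ := hab.trans (by linarith)
      have hb2 : b ≤ a / 2 + κ := by
        rcases le_or_gt ((n : ℝ) * η) (2 * κ - ε) with h | h
        · -- `a = n η ≤ 2κ - ε`, so `a + η ≤ a + ε/2 ≤ a/2 + κ`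
          have haeq : a = (n : ℝ) * η := min_eq_left h
          have hale : a ≤ 2 * κ - ε := haeq ▸ h
          linarith
        · have : a = 2 * κ - ε := min_eq_right h.le
          have hble : b ≤ 2 * κ - ε := min_le_right _ _
          linarith
      exact shell_recursion_step hf0 hfB hC₁ hC₂ hL₁ hS hrec ha0 hD hb0 hb1 hb2
  -- choose `n` with `n η ≥ 2κ - ε`
  obtain ⟨n, hn⟩ := exists_nat_ge ((2 * κ - ε) / η)
  obtain ⟨D, hD⟩ := hQ n
  refine ⟨D, fun L hL => ?_⟩
  have hmin : min ((n : ℝ) * η) (2 * κ - ε) = 2 * κ - ε := by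
    refine min_eq_right ?_
    rwa [div_le_iff₀ hη0] at hn
  have := hD L hL
  rw [hmin] at this
  convert this using 3
  ring

/-- **The endgame of Chae–Shvydkoy's Thm 3.1.**  If, in addition to the shell recursion, the
shell quantity is bounded BELOW by `c L^{-2κ+η}` for large `L` (`c, η > 0`; for the shell
energies of a profile with `|v(y)| ≥ c₀|y|^{-(4-δ)}` one has `e(L) ≳ c₀² L^{-5+2δ}`, i.e.
`κ = 5/2`, `η = 2δ`), we reach a contradiction. [cite: ChaeShvydkoy2013, §3.1 Thm. 3.1] -/
theorem false_of_shell_recursion_of_lower_bound (hf0 : ∀ L, 0 < L → 0 ≤ f L)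
    (hfB : ∀ L, 0 < L → f L ≤ B) (hδ : 0 < δ) (hC₁ : 0 ≤ C₁) (hC₂ : 0 ≤ C₂)
    (hL₁ : 0 < L₁) (hS : ∀ L, S L = ∑ k ∈ range (2 * m + 1), f (2 ^ k * L / 2 ^ m))
    (hrec : ∀ L, L₁ ≤ L → f L ≤ C₁ * L ^ (-δ) * S L + C₂ * Real.sqrt (S L) * L ^ (-κ))
    {c η L₃ : ℝ} (hc : 0 < c) (hη : 0 < η)
    (hlow : ∀ L, L₃ ≤ L → c * L ^ (-(2 * κ) + η) ≤ f L) : False := by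
  obtain ⟨C, hC⟩ := shell_decay_of_recursion hf0 hfB hδ hC₁ hC₂ hL₁ hS hrec
    (half_pos hη)
  -- for `L ≥ max L₃ 1`: `c L^{η/2} ≤ C`
  have hkey : ∀ L, max L₃ 1 ≤ L → c * L ^ (η / 2) ≤ C := by
    intro L hL
    have hL1 : 1 ≤ L := (le_max_right _ _).trans hL
    have hL0 : 0 < L := one_pos.trans_le hL1
    have h1 := (hlow L ((le_max_left _ _).trans hL)).trans (hC L hL1)
    -- multiply by `L^{2κ - η/2} > 0`
    have h2 : c * L ^ (-(2 * κ) + η) * L ^ (2 * κ - η / 2) ≤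
        C * L ^ (-(2 * κ) + η / 2) * L ^ (2 * κ - η / 2) :=
      mul_le_mul_of_nonneg_right h1 (Real.rpow_pos_of_pos hL0 _).le
    rw [mul_assoc, ← Real.rpow_add hL0, mul_assoc, ← Real.rpow_add hL0] at h2
    rw [show -(2 * κ) + η + (2 * κ - η / 2) = η / 2 by ring,
      show -(2 * κ) + η / 2 + (2 * κ - η / 2) = 0 by ring, Real.rpow_zero, mul_one] at h2
    exact h2
  -- but `L^{η/2} → ∞`
  have hev : ∀ᶠ L : ℝ in atTop, C / c < L ^ (η / 2) ∧ max L₃ 1 ≤ L :=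
    ((tendsto_rpow_atTop (half_pos hη)).eventually_gt_atTop (C / c)).and
      (eventually_ge_atTop _)
  obtain ⟨L, hL1, hL2⟩ := hev.exists
  have := hkey L hL2
  rw [div_lt_iff₀ hc] at hL1
  linarith [mul_comm c (L ^ (η / 2))]

end Iteration

end Summit.NavierStokesRegularity.NavierStokesRegularity.Theorems.PowerGaugeEulerLiouville
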